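import Summits.BirchSwinnertonDyer.BirchSwinnertonDyer.Theorems.AdditiveBranchIMCGordTwoRankZeroOffCaseOneFieldSupplyR0Aux
import Literature.NumberTheory.QuadraticFields.JacobiCharacter
import HarnessLib

/-!
# Euler-system half at `p ≥ 5`, crux `ErratumRoadFive.EulerHalfNotRamNoInertSetAtFive` (item stmt-BirchSwinnertonDyer-19715), crux idea
# `ramified-twin-ram-transport` — the GENUS FRAME'S TWIST SUPPLY, part 1: arithmetic of the auxiliary prime and of the twisting parameter

Width seat `bsd-line-er5-p1-w6` g9 (cell `bsd-stepL`); helper `--supports stmt-BirchSwinnertonDyer-19715`; THEOREMS ONLY (pure arithmetic: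
no definition, no named fact, no `sorry`; nothing about any curve is asserted; BSD is proved for no curve).

The idea card (`Cruxes/EulerHalfNotRamNoInertSetAtFive/Ideas/ramified-twin-ram-transport.md`, bsd-idea-9 g14) ramifies the Kolyvagin field
`K` of the S1b core at an odd additive potentially multiplicative prime `q` of `E`, so that the twin `E^{(d_K)}` is multiplicative and
(ram) at `q` and its `≥`-half is Skinner 2016 Thm. C; its fourth typed statement `GenusFrameTwistSupply` asks for such a `K` with every
other bad prime split, the twin NONSPLIT at `q` (Cai–Shu–Tian's Heegner condition (2) for `(E ⊗ χ_{q*}, K, χ₀)`) and `L(E^{(d_K)}, 1) ≠ 0`.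
Part 2 (`…GenusFrameTwistSupply.lean`) derives that supply at `q ≥ 5` from Hoffstein–Luo 1997 (conjunct `hHL` of the route item
`PublishedInputsFive`) and the Modularity Theorem — NO new named fact — along bsd-addord's FIELD-2 recipe for the (M) cell of crux
`MultLower` (`ThreeFieldRoadSupply.exists_ramifiedClass_partner_mult`) and bsd-wall's habitat sign law: `d_K = q*·ℓ₀*·n` with ONE auxiliary
Dirichlet prime `ℓ₀` carrying the class at `q`, the residues at the other bad primes and the class mod `8`, and `n ≡ 1 (mod 8)`,
`n > 0`, Hoffstein–Luo's twisting parameter of the auxiliary curve `E^{(q*ℓ₀*)}` (root number `+1`). This file is the arithmetic: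

* `int_gcd_pStar_eq_one` — `gcd(±q, ℓ) = 1` for primes `ℓ ≠ q`;
* `exists_auxPrime` — for an odd prime `q`, a sign `ε = ±1`, a modulus `M` prime to `q` and a bound `B`: a prime `ℓ₀ > B`,
  `ℓ₀ ∉ {2, q}`, `ℓ₀ ∤ M`, with `q*·ℓ₀* < 0`, `q*·ℓ₀* ≡ 1 (mod 8)`, `(ℓ₀*/q) = ε` and `(ℓ₀*/ℓ) = (q*/ℓ)` at every odd prime `ℓ ∣ M`
  (bsd-addord's `ThreeFieldRoadSupply.exists_prime_star_prescribed` — Dirichlet + CRT — with the dummy second prime `17 ≡ 1 (mod 8)`);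
* `int_gcd_eq_one_of_forall_prime` — `gcd(n, N) = 1` for `n` odd with `(n/ℓ) = 1` at the odd primes of `N`
  (bsd-addord's `ThreeFieldRoadSupply.not_dvd_of_jacobiSym_eq_one` prime by prime);
* `jacobiSym_natCast_natAbs_eq_one` — for `n ≡ 1 (mod 8)`, `N ≠ 0`, `(n/ℓ) = 1` at the odd primes `ℓ ∣ N`: `(N/|n|) = 1`
  (Jacobi reciprocity prime by prime on the odd part, `(2/|n|) = χ₈(|n|) = 1`);
* `pos_of_jacobiSym_neg_one_natAbs` — `n ≡ 1 (mod 4)` with `(−1/|n|) = 1` is positive.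

References (locators only): [cite: IrelandRosen1990, Ch. 5 §2 Prop. 5.2.2; Ch. 16 §1] [cite: Cox2013, §1.C Lemma 1.14].
-/

set_option autoImplicit false
-- D-0017: single-problem summit, so `Summit.BirchSwinnertonDyer.BirchSwinnertonDyer.…` repeats the name by design
set_option linter.dupNamespace false

noncomputable section

open scoped Classical NumberTheorySymbols

namespace Summit.BirchSwinnertonDyer.BirchSwinnertonDyer.Theorems.EulerHalfGenusFrame

open ZMod Summit.BirchSwinnertonDyer.BirchSwinnertonDyer.Theorems.ThreeFieldRoadSupply

/-- `gcd(q*, ℓ) = 1` (`q* = ±q`) for primes `ℓ ≠ q`. [folklore] -/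
theorem int_gcd_pStar_eq_one {q ℓ : ℕ} (hq : q.Prime) (hℓ : ℓ.Prime) (hℓq : ℓ ≠ q) :
    Int.gcd ((-1 : ℤ) ^ (q / 2) * q) ℓ = 1 := by
  rw [Int.gcd_eq_natAbs]
  simp only [Int.natAbs_mul, Int.natAbs_pow, Int.natAbs_neg, Int.natAbs_one, one_pow, one_mul,
    Int.natAbs_natCast]
  exact (Nat.coprime_primes hq hℓ).mpr (Ne.symm hℓq)

/-! ## §1 The auxiliary prime `ℓ₀` -/

/-- **The auxiliary prime of the genus frame.** `q` an odd prime, `q* = (−1)^{(q−1)/2} q`; `ε = ±1`; `M ≠ 0` prime to `q`; `B` a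
bound. There is a prime `ℓ₀ > B`, `ℓ₀ ≠ 2`, `ℓ₀ ≠ q`, `ℓ₀ ∤ M`, with `q*·ℓ₀* < 0`, `q*·ℓ₀* ≡ 1 (mod 8)`, `(ℓ₀*/q) = ε`, and
`(ℓ₀*/ℓ) = (q*/ℓ)` for every odd prime `ℓ ∣ M` (so that `(q*ℓ₀*/ℓ) = 1`). Dirichlet's theorem on primes in progressions with CRT,
through `ThreeFieldRoadSupply.exists_prime_star_prescribed` (sign `−(−1)^{(q−1)/2}`, second prime `17`, `17* = 17 ≡ 1 (mod 8)`, bound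
`max B (max M q)`). [cite: IrelandRosen1990, Ch. 16 §1 (Dirichlet's theorem)] -/
theorem exists_auxPrime {q : ℕ} (hq : q.Prime) (hq2 : q ≠ 2) {ε : ℤ} (hε : ε = 1 ∨ ε = -1)
    {M : ℕ} (hM0 : M ≠ 0) (hqM : ¬ q ∣ M) (B : ℕ) :
    ∃ ℓ₀ : ℕ, ℓ₀.Prime ∧ B < ℓ₀ ∧ ℓ₀ ≠ 2 ∧ ℓ₀ ≠ q ∧ ¬ ℓ₀ ∣ M ∧
      (-1 : ℤ) ^ (q / 2) * q * ((-1 : ℤ) ^ (ℓ₀ / 2) * ℓ₀) < 0 ∧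
      ((-1 : ℤ) ^ (q / 2) * q * ((-1 : ℤ) ^ (ℓ₀ / 2) * ℓ₀)) % 8 = 1 ∧
      J((-1 : ℤ) ^ (ℓ₀ / 2) * ℓ₀ | q) = ε ∧
      ∀ ℓ : ℕ, ℓ.Prime → ℓ ∣ M → ℓ ≠ 2 → J((-1 : ℤ) ^ (ℓ₀ / 2) * ℓ₀ | ℓ) = J((-1 : ℤ) ^ (q / 2) * q | ℓ) := by
  -- the prescribed set: `q` and the odd primes of `M`
  set S : Finset ℕ := insert q (M.primeFactors.filter (· ≠ 2)) with hS
  have hSodd : ∀ ℓ ∈ S, ℓ.Prime ∧ ℓ ≠ 2 := by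
    intro ℓ hℓ
    rcases Finset.mem_insert.mp hℓ with rfl | hℓ
    · exact ⟨hq, hq2⟩
    · obtain ⟨hℓM, hℓ2⟩ := Finset.mem_filter.mp hℓ
      exact ⟨Nat.prime_of_mem_primeFactors hℓM, hℓ2⟩
  -- the prescribed signs
  set η : ℕ → ℤ := fun ℓ ↦ if ℓ = q then ε else J((-1 : ℤ) ^ (q / 2) * q | ℓ) with hη
  have hη1 : ∀ ℓ ∈ S, η ℓ = 1 ∨ η ℓ = -1 := by
    intro ℓ hℓ
    by_cases hℓq : ℓ = q
    · simp only [hη, hℓq, if_true]; exact hε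
    · simp only [hη, hℓq, if_false]
      rcases Finset.mem_insert.mp hℓ with h | h
      · exact absurd h hℓq
      obtain ⟨hℓM, -⟩ := Finset.mem_filter.mp h
      exact jacobiSym.eq_one_or_neg_one (int_gcd_pStar_eq_one hq (Nat.prime_of_mem_primeFactors hℓM) hℓq)
  -- the sign: `ℓ₀*` of sign opposite to `q*`
  set σ : ℤ := -(-1 : ℤ) ^ (q / 2) with hσ
  have hσ1 : σ = 1 ∨ σ = -1 := by
    rcases neg_one_pow_eq_or ℤ (q / 2) with h | h <;> rw [hσ, h] <;> norm_num
  obtain ⟨ℓ₀, hℓ₀, hBℓ₀, hsgn, h8, hJ⟩ :=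
    exists_prime_star_prescribed hq hq2 (by norm_num : (17 : ℕ).Prime)
      (by norm_num) hσ1 S hSodd η hη1 (max B (max M q))
  have hB' : B < ℓ₀ := lt_of_le_of_lt (le_max_left _ _) hBℓ₀
  have hMℓ₀ : M < ℓ₀ := lt_of_le_of_lt ((le_max_left _ _).trans (le_max_right _ _)) hBℓ₀
  have hqℓ₀ : q < ℓ₀ := lt_of_le_of_lt ((le_max_right _ _).trans (le_max_right _ _)) hBℓ₀
  have hℓ₀q : ℓ₀ ≠ q := fun h ↦ by omega
  have hℓ₀M : ¬ ℓ₀ ∣ M := fun h ↦ by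
    have := Nat.le_of_dvd (Nat.pos_of_ne_zero hM0) h
    omega
  have hℓ₀2 : ℓ₀ ≠ 2 := by
    rintro rfl
    -- then `q < 2`, impossible for a prime
    exact absurd hqℓ₀ (not_lt.mpr hq.two_le)
  refine ⟨ℓ₀, hℓ₀, hB', hℓ₀2, hℓ₀q, hℓ₀M, ?_, ?_, ?_, ?_⟩
  · -- sign: `q* ℓ₀* = (−1)^{q/2} q σ ℓ₀ = −((−1)^{q/2})² q ℓ₀ < 0`
    rw [hsgn, hσ]
    have hsq : ((-1 : ℤ) ^ (q / 2)) * ((-1 : ℤ) ^ (q / 2)) = 1 := by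
      rcases neg_one_pow_eq_or ℤ (q / 2) with h | h <;> rw [h] <;> norm_num
    have hpos : (0 : ℤ) < (q : ℤ) * ℓ₀ := by
      have := hq.pos; have := hℓ₀.pos; positivity
    nlinarith [hsq, hpos]
  · -- mod 8: `17* = 17 ≡ 1`
    have h8' : ((-1 : ℤ) ^ (q / 2) * q * ((-1 : ℤ) ^ (ℓ₀ / 2) * ℓ₀) * 17) % 8 = 1 := by
      have e : (-1 : ℤ) ^ (q / 2) * q * ((-1 : ℤ) ^ (ℓ₀ / 2) * ℓ₀) * 17 =
          (-1 : ℤ) ^ (q / 2) * q * ((-1 : ℤ) ^ ((17 : ℕ) / 2) * ((17 : ℕ) : ℤ)) * ((-1 : ℤ) ^ (ℓ₀ / 2) * ℓ₀) := by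
        norm_num; ring
      rw [e]; exact h8
    generalize (-1 : ℤ) ^ (q / 2) * q * ((-1 : ℤ) ^ (ℓ₀ / 2) * ℓ₀) = t at h8'
    omega
  · -- at `q`
    have hqS : q ∈ S := Finset.mem_insert_self _ _
    rw [hJ q hqS]
    simp [hη]
  · intro ℓ hℓ hℓM hℓ2
    have hℓq : ℓ ≠ q := by rintro rfl; exact hqM hℓM
    have hℓS : ℓ ∈ S := Finset.mem_insert_of_mem
      (Finset.mem_filter.mpr ⟨Nat.mem_primeFactors.mpr ⟨hℓ, hℓM, hM0⟩, hℓ2⟩)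
    rw [hJ ℓ hℓS]
    simp [hη, hℓq]

/-! ## §2 The twisting parameter `n ≡ 1 (mod 8)`: `(N/|n|) = 1`, the sign of `n`, `gcd(n, N) = 1` -/

/-- **`gcd(n, N) = 1`** for `n` odd with `(n/ℓ) = 1` at every odd prime `ℓ ∣ N`. [folklore] -/
theorem int_gcd_eq_one_of_forall_prime {n : ℤ} (hn2 : n % 2 = 1) {N : ℕ}
    (h : ∀ ℓ : ℕ, ℓ.Prime → ℓ ∣ N → ℓ ≠ 2 → J(n | ℓ) = 1) : Int.gcd n N = 1 := by
  rw [Int.gcd_eq_natAbs, Int.natAbs_natCast]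
  refine Nat.coprime_of_dvd fun k hk hkn hkN ↦ ?_
  by_cases hk2 : k = 2
  · subst hk2
    have : (2 : ℤ) ∣ n := Int.natAbs_dvd_natAbs.mp (by simpa using hkn)
    omega
  · exact not_dvd_of_jacobiSym_eq_one hk (h k hk hkN hk2) (Int.natAbs_dvd_natAbs.mp (by simpa using hkn))

/-- **`(N / |n|) = 1`** for `n ≡ 1 (mod 8)`, `N ≠ 0`, `(n/ℓ) = 1` at every odd prime `ℓ ∣ N`: write `N = 2^e m` with `m` odd;
`(m/|n|) = (n/m) = ∏ (n/ℓ) = 1` (Jacobi reciprocity for `n ≡ 1 (mod 4)`, prime by prime) and `(2/|n|) = χ₈(|n|) = 1` because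
`|n| ≡ ±1 (mod 8)`. [cite: IrelandRosen1990, Ch. 5 §2 Prop. 5.2.2 (Jacobi reciprocity)] -/
theorem jacobiSym_natCast_natAbs_eq_one {n : ℤ} (hn8 : n % 8 = 1) {N : ℕ} (hN0 : N ≠ 0)
    (h : ∀ ℓ : ℕ, ℓ.Prime → ℓ ∣ N → ℓ ≠ 2 → J(n | ℓ) = 1) : J((N : ℤ) | n.natAbs) = 1 := by
  have hn4 : n % 4 = 1 := by omega
  have hnodd : Odd n.natAbs := Int.natAbs_odd.mpr (Int.odd_iff.mpr (by omega))
  obtain ⟨e, m, hm, hN⟩ := Nat.exists_eq_two_pow_mul_odd hN0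
  have hm0 : m ≠ 0 := by rintro rfl; simp at hm
  -- the odd part
  have hJm : J((m : ℤ) | n.natAbs) = 1 := by
    rw [Literature.NumberTheory.QuadraticFields.jacobiSym_natAbs_eq_of_emod_four_eq_one hn4 hm]
    refine jacobiSym_eq_one_of_forall_prime n hm0 fun ℓ hℓ hℓm ↦ h ℓ hℓ ?_ ?_
    · rw [hN]; exact Dvd.dvd.mul_left hℓm _
    · rintro rfl
      exact (Nat.not_even_iff_odd.mpr hm) (even_iff_two_dvd.mpr hℓm)
  -- the power of two
  have hJ2 : J(2 | n.natAbs) ^ e = 1 := by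
    rcases Nat.eq_zero_or_pos e with rfl | _
    · rw [pow_zero]
    · have hu8 : n.natAbs % 8 = 1 ∨ n.natAbs % 8 = 7 := by omega
      have hodd' : n.natAbs % 2 = 1 := by omega
      rw [jacobiSym.at_two hnodd, ZMod.χ₈_nat_eq_if_mod_eight]
      simp only [hodd', one_ne_zero, if_false, hu8, if_true, one_pow]
  rw [hN, Nat.cast_mul, Nat.cast_pow, jacobiSym.mul_left, jacobiSym.pow_left, Nat.cast_ofNat, hJ2, hJm, one_mul]

/-- **`n ≡ 1 (mod 4)` with `(−1/|n|) = 1` is POSITIVE** (`(−1/|n|) = χ₄(|n|)` and `|n| ≡ 3 (mod 4)` for `n < 0`). [folklore] -/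
theorem pos_of_jacobiSym_neg_one_natAbs {n : ℤ} (hn4 : n % 4 = 1) (h : J(-1 | n.natAbs) = 1) : 0 < n := by
  by_contra hle
  have hneg : n < 0 := lt_of_le_of_ne (not_lt.mp hle) (by rintro rfl; norm_num at hn4)
  have hodd : Odd n.natAbs := Int.natAbs_odd.mpr (Int.odd_iff.mpr (by omega))
  have h3 : n.natAbs % 4 = 3 := by omega
  have h2 : n.natAbs % 2 = 1 := by omega
  rw [jacobiSym.at_neg_one hodd, ZMod.χ₄_nat_eq_if_mod_four] at h
  simp only [h2, one_ne_zero, if_false, h3, show (3 : ℕ) ≠ 1 by decide] at h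
  exact absurd h (by decide)

end Summit.BirchSwinnertonDyer.BirchSwinnertonDyer.Theorems.EulerHalfGenusFrame

end
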